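import Literature.Analysis.FluidPDE.QuasiSelfSimilarMoveSP02Checks1
import Literature.Analysis.FluidPDE.QuasiSelfSimilarMoveSC
import HarnessLib

/-!
# Straight move, phase 2: assembled checks and the slot

Topic `Literature/Analysis/FluidPDE`. Emitted data / kernel certificates of the explicit straight generating
move (`S`) in the typed-chain model, under the contract of `PlanarGeneratorAssembly.lean`
(`acm_compatible_blocks_of_slots`). Generated by the author's emitter from the exact rational design;
no named facts, every theorem is decided in the kernel or assembled from decided chunks. [folklore]

## References

* G. Alberti, G. Crippa, A. L. Mazzucato, *Exponential self-similar mixing by incompressible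
  flows*, J. Amer. Math. Soc. 32 (2019), 445–490, §8 (arXiv:1605.02090).
-/

noncomputable section

namespace Literature.Analysis.FluidPDE.QuasiSelfSimilar.MoveS

open PlanarKinematics QuasiSelfSimilar

set_option maxHeartbeats 4000000 in
/-- Node count. [folklore] -/
theorem P02_K : P02.K = 25 := by decide +kernel

/-- Kernel check of element validity (all nodes). [folklore] -/
theorem P02_valid : ∀ k < 25, (P02.node k).e.validB = true :=
  (forall_lt_of_chunk (forall_lt_zero fun k => (P02.node k).e.validB = true) P02_valid_c0)

/-- Kernel check of positivity (all nodes). [folklore] -/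
theorem P02_pos : ∀ k < 25, (decide (0 < (P02.node k).box.ρ) && decide (0 < (P02.node k).step.len)) = true :=
  (forall_lt_of_chunk (forall_lt_zero fun k => (decide (0 < (P02.node k).box.ρ) && decide (0 < (P02.node k).step.len)) = true) P02_pos_c0)

/-- Kernel check of the node geometry (orders, pieces, cover tags) (all nodes). [folklore] -/
theorem P02_geo : ∀ k < 25, P02.geomAtB k = true :=
  (forall_lt_of_chunk (forall_lt_zero fun k => P02.geomAtB k = true) P02_geo_c0)

/-- Kernel check of box separation rows (all nodes). [folklore] -/
theorem P02_sep : ∀ k < 25, P02.sepRowB k = true :=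
  (forall_lt_of_chunk (forall_lt_zero fun k => P02.sepRowB k = true) P02_sep_c0)

/-- Kernel check of junction agreement (all nodes). [folklore] -/
theorem P02_agr : ∀ k < 25, P02.agreeAtB k = true :=
  (forall_lt_of_chunk (forall_lt_zero fun k => P02.agreeAtB k = true) P02_agr_c0)

/-- `elemsValidB` of phase 2. [folklore] -/
theorem P02_elemsValidB : P02.elemsValidB = true :=
  PhaseQ.elemsValidB_of_forall (by decide +kernel) (by rw [P02_K]; exact P02_valid)

/-- `allPosB` of phase 2. [folklore] -/
theorem P02_allPosB : P02.allPosB = true :=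
  PhaseQ.allPosB_of_forall (by rw [P02_K]; exact P02_pos)

/-- `geomB` of phase 2. [folklore] -/
theorem P02_geomB : P02.geomB = true :=
  PhaseQ.geomB_of_geomAtB P02_elemsValidB P02_allPosB (by rw [P02_K]; exact P02_geo)

/-- `boxSepB` of phase 2. [folklore] -/
theorem P02_boxSepB : P02.boxSepB = true :=
  PhaseQ.boxSepB_of_sepRowB (by rw [P02_K]; exact P02_sep)

/-- `agreeB` of phase 2. [folklore] -/
theorem P02_agreeB : P02.agreeB = true :=
  PhaseQ.agreeB_of_agreeAtB (by rw [P02_K]; exact P02_agr)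

set_option maxHeartbeats 4000000 in
/-- `gateOKB` of phase 2 on its slot. [folklore] -/
theorem P02_gateOKB : P02.gateOKB C_S stub02 (mkRat (2) 15) = true := by decide +kernel

/-- Slot 2 of the straight move. [folklore] -/
def slot02 : Slot := ⟨P02, (mkRat (2) 15), stub02, rc02, rc02'⟩
/-- Slot test of slot 2. [folklore] -/
theorem slot02_okB : slot02.okB C_S (genGate .S) (mkRat (3) 200) = true :=
  Slot.okB_intro (s := slot02) P02_geomB P02_boxSepB P02_agreeB P02_gateOKB rfl (by decide)

end Literature.Analysis.FluidPDE.QuasiSelfSimilar.MoveS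

end
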